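import Summits.CriticalPhenomena.PercolationContinuityZ3.Theorems.Transplant.PlanarSkeletonFrmQuasiDefs
import Summits.CriticalPhenomena.PercolationContinuityZ3.Theorems.Transplant.SkelFrmQuasiBChoiceCreep2
import Summits.CriticalPhenomena.PercolationContinuityZ3.Theorems.Transplant.SkelFrmBChoiceCreep2
import Summits.CriticalPhenomena.PercolationContinuityZ3.Theorems.Transplant.SkelFrmQuasi1ChoiceDefs
import Summits.CriticalPhenomena.PercolationContinuityZ3.Theorems.Transplant.SkelFrmQuasi1ParamsLBL
import Summits.CriticalPhenomena.PercolationContinuityZ3.Theorems.Transplant.SkelFrmQuasiBChoiceArrival2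
import Summits.CriticalPhenomena.PercolationContinuityZ3.Theorems.Transplant.SkelFrmQuasiBChoiceNums
import Summits.CriticalPhenomena.PercolationContinuityZ3.Theorems.Transplant.SkelFrmQuasiBChoiceReadNums
import Summits.CriticalPhenomena.PercolationContinuityZ3.Theorems.Transplant.SkelFrmQuasiBChoiceReadNums3
import Summits.CriticalPhenomena.PercolationContinuityZ3.Theorems.Transplant.SkelFrmQuasiBChoiceReadings
import Summits.CriticalPhenomena.PercolationContinuityZ3.Theorems.Transplant.SkelFrmQuasiBChoiceWindow3
import Summits.CriticalPhenomena.PercolationContinuityZ3.Theorems.Transplant.SkelFrmQuasiBParamsCorrKG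
import Summits.CriticalPhenomena.PercolationContinuityZ3.Theorems.Transplant.SkelFrmQuasiBParamsCorrKG0
import Summits.CriticalPhenomena.PercolationContinuityZ3.Theorems.Transplant.SkelFrmQuasiBParamsCorrKGLen3
import Summits.CriticalPhenomena.PercolationContinuityZ3.Theorems.Transplant.SkelFrmQuasiBParamsLF
import Summits.CriticalPhenomena.PercolationContinuityZ3.Theorems.Transplant.SkelFrmQuasiBParamsLFA
import Summits.CriticalPhenomena.PercolationContinuityZ3.Theorems.Transplant.SkelFrmQuasiBParamsSchedA
import HarnessLib
import Summits.CriticalPhenomena.PercolationContinuityZ3.Theorems.Transplant.SkelFrmBChoiceHabXW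
/-!
# GEN-Q PORT (WAVE-Q table v0.8 section 2, row G158, U-level L18; captain R-6/R-7 2026-08-27: carrier token swap `PlanarSkeletonFrmFrom ↦ PlanarSkeletonFrmQuasi`)
# of the tree module «Transplant/SkelFrmFromBChoiceHabXW» (sha256 874df878444ba3f8…) onto the quasi-step carrier `PlanarSkeletonFrmQuasi` (p507026): «SkelFrmQuasiBChoiceHabXW»

ORIGINAL TITLE: N2 (frames-only node `SamePDropOfSkeletonFrm₁`, OPEN) — (ζ″) under (R-44)/(R-45): THE V HABITAT ROW FOR THE x-CORRIDOR (rows, axis 1):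

builds on p205010 (kernel theorem, internal audit signed; external expert review pending) — nothing in this file uses p205010; NOTHING is claimed about any open node
((N3-b), the end state).  Lane `prim-bschramm`, seat `prim-bschramm-gen-2` (gen 0; GEN-Q port pen #2 under RULING D-Q / D-Q-2; tool of record port_genq.py of the captain gen-1 g4).  Helper file (`--supports stmt-CriticalPhenomena-4575 --as helper`).
PORT RULES (U-wave r1–r4 re-used, GEN-Q hunk classes of p3-g29 #6136): declaration order, names and proof texts are those of «SkelFrmFromBChoiceHabXW», byte-identical except
(i) the carrier token `PlanarSkeletonFrmFrom ↦ PlanarSkeletonFrmQuasi` in binders, `namespace`/`end` lines and qualified names (module names `SkelFrmFrom… ↦ SkelFrmQuasi…`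
in imports of already-ported rows); (ii) `Φ.step ↦ Φ.qstep` with the called Steps lemma replaced by its `…Q`/`_q` twin and the cost `Φ.M` threaded (none in this file unless
listed below); (iii) `Φ.cyl_connected ↦ Φ.cyl_reach` readers (none unless listed); (iv) graph-ball radii / window floors ×`Φ.M` (none unless listed).  Carrier-free
residents stay imported/exported from the original «SkelFrmBChoiceHabXW» exactly as in the FrmFrom port.  Docstrings and citations are the original's.
HAND HUNKS of this row: none of class (ii); KS0 reader hunk (stmt-g33 #6324, L-FLOORMAP-1 ① reader side): `KS0.R'0 κ Φ … ↦ KS0.R'0N κ Φ (KS.NQ Φ) …` ×2 (`hg2` binders).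
-/

open scoped Classical

noncomputable section

namespace Summit.CriticalPhenomena.PercolationContinuityZ3.Theorems.Transplant

namespace PlanarSkeletonFrmQuasi

export PlanarSkeletonNeg.NegB (Aof)  -- T3-auto: resident alias replicated from the FrmFrom namespace
export PlanarSkeletonNeg.Neg (K)  -- T3-auto: resident alias replicated from the FrmFrom namespace
export PlanarSkeletonNeg.Neg (K_eq)  -- T3-auto: resident alias replicated from the FrmFrom namespace
export PlanarSkeletonNeg.Neg (Kq)  -- T3-auto: resident alias replicated from the FrmFrom namespace
export PlanarSkeletonFrm.NegB (kgSLY_eq_kgSL)  -- T3-auto: resident alias replicated from the FrmFrom namespace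

namespace NegB

open Literature.Probability.Percolation Literature.Probability.LatticeModels SimpleGraph
open Literature.Probability.Percolation.KozmaNitzan.Cells (oth)
open SkelConc (Consts)
open Skelφ (shearUnit kgSL kgM₁ kgM₂ kgE₁ kgA₁ kgCtr2 kgDec₁ kgP rdLo rdHi KGRows)
open TwoAxis.Para (modulus)
open Neg

/-! ## §1 The pure-integer cores -/

export PlanarSkeletonFrm.NegB (floor1_bounds)

export PlanarSkeletonFrm.NegB (habX_core)

/-! ## §2 At the tuple of record -/

section HabX

variable (κ : Consts) {V : Type} [DecidableEq V] [Countable V] {G : SimpleGraph V} [G.LocallyFinite] (Φ : PlanarSkeletonFrmQuasi G) (t : V) (p : unitInterval)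
  (D : Skelφ.StepI.DataNS V) (g f mk : ℕ)

/-- **THE x V HABITAT ROW, BOX FORM**: any frame box whose row top is at most the phase boxes' top reads `rdHi₁ ≤ cRvW 0 + 5·s₁ + 1`. [this work] -/
theorem habX_box_V (κ : Consts) {V : Type} [DecidableEq V] [Countable V] {G : SimpleGraph V} [G.LocallyFinite] (Φ : PlanarSkeletonFrmQuasi G) (t : V) (p : unitInterval) (D : Skelφ.StepI.DataNS V) (g : ℕ) (f : ℕ) (mk : ℕ) (hKq : 5 ≤ Neg.Kq κ) (hN : EqNumL κ Φ t p D g f) (hg : gFloorKG κ Φ t p D mk ≤ g) (hg2 : 40 * Neg.K κ * KS0.R'0N κ Φ (KS.NQ Φ) t p D mk ≤ g)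
    (lo hi : Site 2)
    (hhi : hi 1 ≤ (((kgA₁ (nL κ Φ t p D g f) (ℓL κ Φ t p D g f) (hL κ Φ t p D g f) (kgR κ Φ t p D mk) (kgW κ Φ t p D g f (WxQ4 κ Φ t p D g f)) (kgNv0 κ Φ t p D g f mk (qxQ4 κ Φ t p D g f) (WxQ4 κ Φ t p D g f)) : ℕ) : ℤ) + ((((kgM₁ (nL κ Φ t p D g f) (ℓL κ Φ t p D g f) (hL κ Φ t p D g f) (kgR κ Φ t p D mk) 0 (kgW κ Φ t p D g f (WxQ4 κ Φ t p D g f)) (kgNv0 κ Φ t p D g f mk (qxQ4 κ Φ t p D g f) (WxQ4 κ Φ t p D g f)) : ℕ) : ℤ)) + 1) * ((((kgR κ Φ t p D mk) : ℕ) : ℤ) + ((0 : ℕ) : ℤ)) +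
        (((kgM₂ (nL κ Φ t p D g f) (ℓL κ Φ t p D g f) (hL κ Φ t p D g f) (vL κ Φ t p D g f) (kgR κ Φ t p D mk) 0 (kgq κ Φ t p D g f (qxQ4 κ Φ t p D g f)) (kgW κ Φ t p D g f (WxQ4 κ Φ t p D g f)) (kgNv0 κ Φ t p D g f mk (qxQ4 κ Φ t p D g f) (WxQ4 κ Φ t p D g f)) : ℕ) : ℤ)) * ((((kgR κ Φ t p D mk) : ℕ) : ℤ) + ((0 : ℕ) : ℤ)) + (((kgR κ Φ t p D mk) : ℕ) : ℤ) + ((3 * ((nL κ Φ t p D g f) * (ℓL κ Φ t p D g f)) / (shearUnit (nL κ Φ t p D g f) (hL κ Φ t p D g f)) + 1 : ℕ) : ℤ))) :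
    rdHi (Aof κ) (nL κ Φ t p D g f) (hL κ Φ t p D g f) (vL κ Φ t p D g f) (vβL κ Φ t p D g f) (prFA κ Φ t p D g f).c₀ (prFA κ Φ t p D g f).c₁ (prFA κ Φ t p D g f).D lo hi 1 ≤ ((cRvW κ Φ t p D g f mk 0 : ℕ) : ℤ) + 5 * (((fcellsA κ Φ t p D g f).s 1 : ℕ) : ℤ) + 1 := by
  obtain ⟨-, hsc1, hn1, hA0, hDp, hm, -, -, hkq, -⟩ := hsc_Q κ Φ t p D g f hN
  obtain ⟨hnR', hs40, hbig, hR1, -, -⟩ := valsQ_floor κ Φ t p D g f mk hN hg hg2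
  have hUs := UsL_le_modulus κ Φ t p D g f hN
  have hU1 : (1 : ℤ) ≤ (((shearUnit (nL κ Φ t p D g f) (hL κ Φ t p D g f)) : ℕ) : ℤ) := by exact_mod_cast Skelφ.shearUnit_pos hn1 (hL κ Φ t p D g f)
  have hUpos : 0 < (shearUnit (nL κ Φ t p D g f) (hL κ Φ t p D g f)) := by
    have := Skelφ.shearUnit_pos hn1 (hL κ Φ t p D g f)
    exact_mod_cast this
  have H := kgRows0_of κ Φ t p D g f mk (qxQ4 κ Φ t p D g f) (WxQ4 κ Φ t p D g f) hN hg
  have hE := (H.kgE₁_spec (kgNv0 κ Φ t p D g f mk (qxQ4 κ Φ t p D g f) (WxQ4 κ Φ t p D g f))).2.2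
  have hm2 := m₂Q4_le κ Φ t p D g f mk hN hg hg2
  have h3L : ((3 * ((nL κ Φ t p D g f) * (ℓL κ Φ t p D g f)) / (shearUnit (nL κ Φ t p D g f) (hL κ Φ t p D g f)) : ℕ) : ℤ) ≤ ((3 * ((nL κ Φ t p D g f) * (ℓL κ Φ t p D g f) / (shearUnit (nL κ Φ t p D g f) (hL κ Φ t p D g f))) + 2 : ℕ) : ℤ) := by
    exact_mod_cast Skelφ.natDiv_three_le ((nL κ Φ t p D g f) * (ℓL κ Φ t p D g f)) (shearUnit (nL κ Φ t p D g f) (hL κ Φ t p D g f)) hUpos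
  have hP1 : (((nL κ Φ t p D g f) : ℕ) : ℤ) * (ℓL κ Φ t p D g f) / ((shearUnit (nL κ Φ t p D g f) (hL κ Φ t p D g f)) : ℕ) ≤ kgSL (nL κ Φ t p D g f) (ℓL κ Φ t p D g f) (hL κ Φ t p D g f) + 1 := by
    have := Skelφ.natDiv_le_kgSLY hn1 (ℓL κ Φ t p D g f) (hL κ Φ t p D g f)
    have hP0nat : (((nL κ Φ t p D g f) * (ℓL κ Φ t p D g f) / (shearUnit (nL κ Φ t p D g f) (hL κ Φ t p D g f)) : ℕ) : ℤ) = (((nL κ Φ t p D g f) : ℕ) : ℤ) * (ℓL κ Φ t p D g f) / ((shearUnit (nL κ Φ t p D g f) (hL κ Φ t p D g f)) : ℕ) := by push_cast; rfl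
    rw [hP0nat, kgSLY_eq_kgSL] at this; exact this
  obtain ⟨hsum, -, -, -⟩ := arr1_sum_eq_W κ Φ t p D g f mk hN hg
  -- `K ≥ 200`, `r₁ = 40kq·s₁`, `8000R′ ≤ sL + 1`
  have hKq40 : (Neg.K κ : ℤ) = 40 * ((Neg.Kq κ : ℕ) : ℤ) := by exact_mod_cast Neg.K_eq κ
  have hkq5 : (5 : ℤ) ≤ ((Neg.Kq κ : ℕ) : ℤ) := by exact_mod_cast hKq
  have hr1 : (((fcellsA κ Φ t p D g f).r 1 : ℕ) : ℤ) = 40 * ((Neg.Kq κ : ℕ) : ℤ) * (((fcellsA κ Φ t p D g f).s 1 : ℕ) : ℤ) := by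
    rw [PCells2.r_eq, show ((fcellsA κ Φ t p D g f).K : ℤ) = Neg.K κ by exact_mod_cast (fcellsA_K κ Φ t p D g f).1, hKq40]
  have hs1 : (1 : ℤ) ≤ (((fcellsA κ Φ t p D g f).s 1 : ℕ) : ℤ) := by exact_mod_cast (fcellsA κ Φ t p D g f).hs 1
  have hRR : ((KS0.R'0N κ Φ (KS.NQ Φ) t p D mk : ℕ) : ℤ) = (((kgR κ Φ t p D mk) : ℕ) : ℤ) := rfl
  rw [hRR] at hs40 hR1
  have hR0 : (0 : ℤ) ≤ (((kgR κ Φ t p D mk) : ℕ) : ℤ) := by linarith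
  have hR8000 : 8000 * (((kgR κ Φ t p D mk) : ℕ) : ℤ) ≤ kgSL (nL κ Φ t p D g f) (ℓL κ Φ t p D g f) (hL κ Φ t p D g f) + 1 := by
    have h1 : 200 * (((kgR κ Φ t p D mk) : ℕ) : ℤ) ≤ (Neg.K κ : ℤ) * (((kgR κ Φ t p D mk) : ℕ) : ℤ) := mul_le_mul_of_nonneg_right (by linarith) hR0
    have e : (40 : ℤ) * (Neg.K κ : ℤ) * (((kgR κ Φ t p D mk) : ℕ) : ℤ) = 40 * ((Neg.K κ : ℤ) * (((kgR κ Φ t p D mk) : ℕ) : ℤ)) := by ring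
    rw [e] at hs40; linarith
  have hkq1 : (1 : ℤ) ≤ ((Neg.Kq κ : ℕ) : ℤ) := by linarith
  -- the creep as the midpoint, the readings as floors
  obtain ⟨hc, -⟩ := cRvW_zero_eq κ Φ t p D g f mk hN hg hg2
  rw [hc]
  unfold cmidW
  simp only [Skelφ.rdLo_one, Skelφ.rdHi_one]
  set Xl := ((((shearUnit (nL κ Φ t p D g f) (hL κ Φ t p D g f)) : ℕ) : ℤ) * arrLoQ3 κ Φ t p D g f mk 1) with hXl
  set Xh := ((((shearUnit (nL κ Φ t p D g f) (hL κ Φ t p D g f)) : ℕ) : ℤ) * arrHiQ3 κ Φ t p D g f mk 1 + ((shearUnit (nL κ Φ t p D g f) (hL κ Φ t p D g f)) : ℕ) - 1) with hXh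
  set XT := ((((shearUnit (nL κ Φ t p D g f) (hL κ Φ t p D g f)) : ℕ) : ℤ) * hi 1 + ((shearUnit (nL κ Φ t p D g f) (hL κ Φ t p D g f)) : ℕ) - 1) with hXT
  have hFl := Int.mul_ediv_self_le (x := (prFA κ Φ t p D g f).c₁ * (Aof κ * Xl)) (ne_of_gt hDp)
  have hFl' := Int.lt_mul_ediv_self_add (x := (prFA κ Φ t p D g f).c₁ * (Aof κ * Xl)) hDp
  have hFh := Int.mul_ediv_self_le (x := (prFA κ Φ t p D g f).c₁ * (Aof κ * Xh)) (ne_of_gt hDp)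
  have hFh' := Int.lt_mul_ediv_self_add (x := (prFA κ Φ t p D g f).c₁ * (Aof κ * Xh)) hDp
  have hFT := Int.mul_ediv_self_le (x := (prFA κ Φ t p D g f).c₁ * (Aof κ * XT)) (ne_of_gt hDp)
  have hFT' := Int.lt_mul_ediv_self_add (x := (prFA κ Φ t p D g f).c₁ * (Aof κ * XT)) hDp
  obtain ⟨-, h1⟩ := floor1_bounds hDp hkq1 hm hsc1 hr1 hFl hFl'
  obtain ⟨-, h2⟩ := floor1_bounds hDp hkq1 hm hsc1 hr1 hFh hFh'
  obtain ⟨h3, -⟩ := floor1_bounds hDp hkq1 hm hsc1 hr1 hFT hFT'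
  -- `s₁·X_T(hi 1) ≤ s₁·X_T(Top)`
  have hmono : (((fcellsA κ Φ t p D g f).s 1 : ℕ) : ℤ) * XT ≤ (((fcellsA κ Φ t p D g f).s 1 : ℕ) : ℤ) *
      ((((shearUnit (nL κ Φ t p D g f) (hL κ Φ t p D g f)) : ℕ) : ℤ) * ((((kgA₁ (nL κ Φ t p D g f) (ℓL κ Φ t p D g f) (hL κ Φ t p D g f) (kgR κ Φ t p D mk) (kgW κ Φ t p D g f (WxQ4 κ Φ t p D g f)) (kgNv0 κ Φ t p D g f mk (qxQ4 κ Φ t p D g f) (WxQ4 κ Φ t p D g f)) : ℕ) : ℤ) + ((((kgM₁ (nL κ Φ t p D g f) (ℓL κ Φ t p D g f) (hL κ Φ t p D g f) (kgR κ Φ t p D mk) 0 (kgW κ Φ t p D g f (WxQ4 κ Φ t p D g f)) (kgNv0 κ Φ t p D g f mk (qxQ4 κ Φ t p D g f) (WxQ4 κ Φ t p D g f)) : ℕ) : ℤ)) + 1) * ((((kgR κ Φ t p D mk) : ℕ) : ℤ) + ((0 : ℕ) : ℤ)) +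
        (((kgM₂ (nL κ Φ t p D g f) (ℓL κ Φ t p D g f) (hL κ Φ t p D g f) (vL κ Φ t p D g f) (kgR κ Φ t p D mk) 0 (kgq κ Φ t p D g f (qxQ4 κ Φ t p D g f)) (kgW κ Φ t p D g f (WxQ4 κ Φ t p D g f)) (kgNv0 κ Φ t p D g f mk (qxQ4 κ Φ t p D g f) (WxQ4 κ Φ t p D g f)) : ℕ) : ℤ)) * ((((kgR κ Φ t p D mk) : ℕ) : ℤ) + ((0 : ℕ) : ℤ)) + (((kgR κ Φ t p D mk) : ℕ) : ℤ) + ((3 * ((nL κ Φ t p D g f) * (ℓL κ Φ t p D g f)) / (shearUnit (nL κ Φ t p D g f) (hL κ Φ t p D g f)) + 1 : ℕ) : ℤ))) + ((shearUnit (nL κ Φ t p D g f) (hL κ Φ t p D g f)) : ℕ) - 1) := by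
    refine mul_le_mul_of_nonneg_left ?_ (by linarith)
    have := mul_le_mul_of_nonneg_left hhi (show (0 : ℤ) ≤ (((shearUnit (nL κ Φ t p D g f) (hL κ Φ t p D g f)) : ℕ) : ℤ) by linarith)
    rw [hXT]; linarith
  have hE' : ((kgE₁ (nL κ Φ t p D g f) (ℓL κ Φ t p D g f) (hL κ Φ t p D g f) (kgR κ Φ t p D mk) 0 (kgW κ Φ t p D g f (WxQ4 κ Φ t p D g f)) (kgNv0 κ Φ t p D g f mk (qxQ4 κ Φ t p D g f) (WxQ4 κ Φ t p D g f)) : ℕ) : ℤ) < 2 * ((((nL κ Φ t p D g f) : ℕ) : ℤ) * (ℓL κ Φ t p D g f) / ((shearUnit (nL κ Φ t p D g f) (hL κ Φ t p D g f)) : ℕ) + 1) + (kgSL (nL κ Φ t p D g f) (ℓL κ Φ t p D g f) (hL κ Φ t p D g f) - 2 * (((kgR κ Φ t p D mk) : ℕ) : ℤ)) := by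
    have e : kgDec₁ (nL κ Φ t p D g f) (ℓL κ Φ t p D g f) (hL κ Φ t p D g f) (kgR κ Φ t p D mk) 0 = kgSL (nL κ Φ t p D g f) (ℓL κ Φ t p D g f) (hL κ Φ t p D g f) - 2 * (((kgR κ Φ t p D mk) : ℕ) : ℤ) - ((0 : ℕ) : ℤ) := rfl
    unfold Skelφ.kgP at hE; rw [e] at hE; push_cast at hE ⊢; linarith
  have hsum' : arrLoQ3 κ Φ t p D g f mk 1 + arrHiQ3 κ Φ t p D g f mk 1 =
      2 * (((kgA₁ (nL κ Φ t p D g f) (ℓL κ Φ t p D g f) (hL κ Φ t p D g f) (kgR κ Φ t p D mk) (kgW κ Φ t p D g f (WxQ4 κ Φ t p D g f)) (kgNv0 κ Φ t p D g f mk (qxQ4 κ Φ t p D g f) (WxQ4 κ Φ t p D g f)) : ℕ) : ℤ) + ((((kgM₁ (nL κ Φ t p D g f) (ℓL κ Φ t p D g f) (hL κ Φ t p D g f) (kgR κ Φ t p D mk) 0 (kgW κ Φ t p D g f (WxQ4 κ Φ t p D g f)) (kgNv0 κ Φ t p D g f mk (qxQ4 κ Φ t p D g f) (WxQ4 κ Φ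 t p D g f)) : ℕ) : ℤ)) + 1) * ((((kgR κ Φ t p D mk) : ℕ) : ℤ) + ((0 : ℕ) : ℤ))) -
        ((kgE₁ (nL κ Φ t p D g f) (ℓL κ Φ t p D g f) (hL κ Φ t p D g f) (kgR κ Φ t p D mk) 0 (kgW κ Φ t p D g f (WxQ4 κ Φ t p D g f)) (kgNv0 κ Φ t p D g f mk (qxQ4 κ Φ t p D g f) (WxQ4 κ Φ t p D g f)) : ℕ) : ℤ) := by
    rw [hsum]; unfold Skelφ.kgCtr2; push_cast; ring
  exact habX_core (E₁ := ((kgE₁ (nL κ Φ t p D g f) (ℓL κ Φ t p D g f) (hL κ Φ t p D g f) (kgR κ Φ t p D mk) 0 (kgW κ Φ t p D g f (WxQ4 κ Φ t p D g f)) (kgNv0 κ Φ t p D g f mk (qxQ4 κ Φ t p D g f) (WxQ4 κ Φ t p D g f)) : ℕ) : ℤ))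
    (m₂ := (((kgM₂ (nL κ Φ t p D g f) (ℓL κ Φ t p D g f) (hL κ Φ t p D g f) (vL κ Φ t p D g f) (kgR κ Φ t p D mk) 0 (kgq κ Φ t p D g f (qxQ4 κ Φ t p D g f)) (kgW κ Φ t p D g f (WxQ4 κ Φ t p D g f)) (kgNv0 κ Φ t p D g f mk (qxQ4 κ Φ t p D g f) (WxQ4 κ Φ t p D g f)) : ℕ) : ℤ)))
    (L := ((3 * ((nL κ Φ t p D g f) * (ℓL κ Φ t p D g f)) / (shearUnit (nL κ Φ t p D g f) (hL κ Φ t p D g f)) + 1 : ℕ) : ℤ)) (A₁ := ((kgA₁ (nL κ Φ t p D g f) (ℓL κ Φ t p D g f) (hL κ Φ t p D g f) (kgR κ Φ t p D mk) (kgW κ Φ t p D g f (WxQ4 κ Φ t p D g f)) (kgNv0 κ Φ t p D g f mk (qxQ4 κ Φ t p D g f) (WxQ4 κ Φ t p D g f)) : ℕ) : ℤ))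
    (a₁R := ((((kgM₁ (nL κ Φ t p D g f) (ℓL κ Φ t p D g f) (hL κ Φ t p D g f) (kgR κ Φ t p D mk) 0 (kgW κ Φ t p D g f (WxQ4 κ Φ t p D g f)) (kgNv0 κ Φ t p D g f mk (qxQ4 κ Φ t p D g f) (WxQ4 κ Φ t p D g f)) : ℕ) : ℤ)) + 1) * ((((kgR κ Φ t p D mk) : ℕ) : ℤ) + ((0 : ℕ) : ℤ)))
    (Top := (((kgA₁ (nL κ Φ t p D g f) (ℓL κ Φ t p D g f) (hL κ Φ t p D g f) (kgR κ Φ t p D mk) (kgW κ Φ t p D g f (WxQ4 κ Φ t p D g f)) (kgNv0 κ Φ t p D g f mk (qxQ4 κ Φ t p D g f) (WxQ4 κ Φ t p D g f)) : ℕ) : ℤ) + ((((kgM₁ (nL κ Φ t p D g f) (ℓL κ Φ t p D g f) (hL κ Φ t p D g f) (kgR κ Φ t p D mk) 0 (kgW κ Φ t p D g f (WxQ4 κ Φ t p D g f)) (kgNv0 κ Φ t p D g f mk (qxQ4 κ Φ t p D g f) (WxQ4 κ Φ t p D g f)) : ℕ) : ℤ)) + 1) * ((((kgR κ Φ t p D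 mk) : ℕ) : ℤ) + ((0 : ℕ) : ℤ)) +
        (((kgM₂ (nL κ Φ t p D g f) (ℓL κ Φ t p D g f) (hL κ Φ t p D g f) (vL κ Φ t p D g f) (kgR κ Φ t p D mk) 0 (kgq κ Φ t p D g f (qxQ4 κ Φ t p D g f)) (kgW κ Φ t p D g f (WxQ4 κ Φ t p D g f)) (kgNv0 κ Φ t p D g f mk (qxQ4 κ Φ t p D g f) (WxQ4 κ Φ t p D g f)) : ℕ) : ℤ)) * ((((kgR κ Φ t p D mk) : ℕ) : ℤ) + ((0 : ℕ) : ℤ)) + (((kgR κ Φ t p D mk) : ℕ) : ℤ) + ((3 * ((nL κ Φ t p D g f) * (ℓL κ Φ t p D g f)) / (shearUnit (nL κ Φ t p D g f) (hL κ Φ t p D g f)) + 1 : ℕ) : ℤ)))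
    (hU := hU1) (hUs := hUs) (hs := hbig) (hs1 := hs1) (hR0 := hR0) (hR := hR8000) (hP1 := hP1) (hE1 := hE')
    (hm2 := by linarith [hm2]) (hL := by push_cast at h3L ⊢; linarith) (hTop := by push_cast; ring) (hC := hsum')
    (hFT := le_trans h3 hmono) (hFl := h1) (hFh := h2)

end HabX

end NegB

end PlanarSkeletonFrmQuasi

end Summit.CriticalPhenomena.PercolationContinuityZ3.Theorems.Transplant

end
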